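import Summits.BirchSwinnertonDyer.BirchSwinnertonDyer.Theorems.PrintCf2RamifiedOffTYZEvenSquareFormMatrixBridge
import Summits.BirchSwinnertonDyer.BirchSwinnertonDyer.Theorems.PrintCf2RamifiedOffTYZSelmerRankOneMoverSix
import Summits.BirchSwinnertonDyer.BirchSwinnertonDyer.Theorems.PrintCf2RamifiedOffTYZMoverKummerBits
import Literature.NumberTheory.EllipticCurves.TianYuanZhang2017.CMPointFrobeniusValueDisplays
import HarnessLib

/-!
# Crux `PrintCf2.RamifiedOffTYZOfFacts` (stmt-BirchSwinnertonDyer-20509), line `offtyz-v7`, LEAD cycle 14 (cruxlead-20509 g13):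
# THE EVEN Ω-IDENTITY ⟹ A SQUARE MOVER AT `s = 1` ⟹ `#Sel₂ = 8 ⟹ BSD₂` ON ALL OF SMITH'S `S(6)` (conditional on a pure Legendre-symbol identity)

THEOREMS ONLY (no `def`, no named fact, no `sorry`), `--supports stmt-BirchSwinnertonDyer-20509` (item 23432, `s = 1` even stratum).  The second
consumer of `galPt_mul_self_P_eq_add_evenSquareFormMatrix` (`…EvenSquareFormMatrixBridge`): IF the even Ω-identity holds for the tuple `p`
(`∀ x, evenSquareFormMatrix p x = evenOmegaFormMatrix p x`, conjecture `EvenOmegaMatrixIdentity`), then at `#Sel₂(E_n) = 8` the adjugate of Monsky's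
even matrix is `u·(u∘swap)ᵀ` for the kernel generator `u ≠ 0` (§1, Horn–Johnson §0.8.2 as in p711401), so the Ω-form takes the value `1` at the bits
`(0, 1, e_j)` if `u_{inl j} = 1` (the Kummer element) or at `(1, 0, e_j)` if `u¹ = 0`, `u_{inr j} = 1` — bits realised by an automorphism by Kummer
independence (`MoverKummerBits.exists_aut_im_bits_eq`, p689938) — hence SOME SQUARE MOVES `P(n)` (§2) and the even door p677864 gives
`ord = rank = 1 ∧ Ш[2^∞] = 0 ∧ BSD₂` for EVERY square-free `n ≡ 6 (mod 8)` with `#Sel₂ = 8` (§3; no `u¹ ≠ 0` / adjugate / class-number hypothesis left).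
The hypothesis is an explicit decidable `𝔽₂`-identity — NOT a named fact, NOT asserted.  BSD is not proved by any of this; no class is closed here.

References: [cite: TianYuanZhang2017, Thm. 1.1, Thm. 3.5, Lemma 3.18, §3.1, Prop. 3.2 (2), Thm. 3.6 (2), proof of Lemma 3.21];
[cite: HeathBrown1994SelmerCongruentII, Appendix (Monsky), typescript p. 41 L20–L36]; [cite: HornJohnson2013, §0.8.2 (p. 22)]; [cite: Cox2013, Thm. 6.1].
-/

noncomputable section

open scoped Classical NumberField

open WeierstrassCurve WeierstrassCurve.Affine Finset Matrix Literature.NumberTheory.EllipticCurves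
  Literature.NumberTheory.EllipticCurves.TianYuanZhang2017
  Literature.NumberTheory.EllipticCurves.TianYuanZhang2017.W2
  Literature.NumberTheory.EllipticCurves.HeathBrown1994
  Literature.NumberTheory.EllipticCurves.HeathBrown1994.Families
  Literature.NumberTheory.EllipticCurves.Smith2016
  Literature.NumberTheory.EllipticCurves.MonskySelmerParity
  Literature.NumberTheory.QuadraticFields.RingClass
  Literature.NumberTheory.QuadraticFields
  Literature.LinearAlgebra.Matrix
  Summit.BirchSwinnertonDyer.Rank1Residual.P2.GenusPeriodTransferLayer
  Summit.BirchSwinnertonDyer.PrintCf2.QForm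
  Summit.BirchSwinnertonDyer.PrintCf2.QFormForest
  Summit.BirchSwinnertonDyer.PrintCf2.EvenOmegaDefs

set_option autoImplicit false

namespace Summit.BirchSwinnertonDyer.PrintCf2.MoverAssembly

variable {k : ℕ} (p : Fin k → ℕ) (hp : ∀ i, (p i).Prime) (hodd : ∀ i, Odd (p i)) (hinj : Function.Injective p)

/-! ## §1 `adj(M_even) = u·(u∘swap)ᵀ` at `#Sel₂ = 8` -/

include hp hodd hinj in
/-- **`adj(M_even)_{r j} = u_r · u_{swap j}`** for the kernel generator `u = kerSum M_even` when `#Sel₂(E_{2m}) = 8` (columns in the kernel line,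
rows in the left kernel line `u∘swap`, `adj ≠ 0`). [cite: HornJohnson2013, §0.8.2 (adjugate of a matrix of rank n − 1)] [cite: HeathBrown1994SelmerCongruentII, Appendix (Monsky)] -/
theorem adjugate_monskyEven_apply_eq_kerSum_mul (hsel : Nat.card ((congruentNumberCurve (2 * ∏ i, p i)).selmerGroup 2) = 8)
    (r j : Fin k ⊕ Fin k) :
    (monskyMatrixEven p).adjugate r j = kerSum (monskyMatrixEven p) r * kerSum (monskyMatrixEven p) (Sum.swap j) := by
  set M := monskyMatrixEven p with hM
  have hcard := card_ker_monskyEven_eq_two_of_card_selmer_eight p hp hodd hinj hsel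
  obtain ⟨hne, hker⟩ := ker_iff_of_card_eq_two M hcard
  set u := kerSum M with hu
  have hMu : M *ᵥ u = 0 := (hker u).mpr (Or.inr rfl)
  have hdet : M.det = 0 := Matrix.exists_mulVec_eq_zero_iff.mp ⟨u, hne, hMu⟩
  have hcardT : Fintype.card {v : Fin k ⊕ Fin k → ZMod 2 // Mᵀ *ᵥ v = 0} = 2 := by rw [card_ker_transpose, hcard]
  obtain ⟨hneT, hkerT⟩ := ker_iff_of_card_eq_two Mᵀ hcardT
  have huT : Mᵀ *ᵥ (fun c => u (Sum.swap c)) = 0 := by rw [mulVec_transpose]; exact swap_vecMul_monskyMatrixEven_eq_zero p hMu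
  have huT0 : (fun c => u (Sum.swap c)) ≠ 0 := by
    intro h0; apply hne; funext c
    have := congrFun h0 (Sum.swap c); simp only [Sum.swap_swap, Pi.zero_apply] at this; exact this
  have hlineT : kerSum Mᵀ = fun c => u (Sum.swap c) := by
    rcases (hkerT _).mp huT with h | h
    · exact absurd h huT0
    · exact h.symm
  have hleft : ∀ x : Fin k ⊕ Fin k → ZMod 2, x ᵥ* M = 0 → x = 0 ∨ x = fun c => u (Sum.swap c) := by
    intro x hx; rw [← hlineT]; exact (hkerT x).mp (by rw [mulVec_transpose]; exact hx)
  have hadj : M.adjugate ≠ 0 := by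
    refine adjugate_ne_zero_of_vecMul_line M (fun c => u (Sum.swap c)) (fun x hx => ?_) r
    rcases hleft x hx with h | h
    · exact ⟨0, by rw [h, zero_smul]⟩
    · exact ⟨1, by rw [h, one_smul]⟩
  have hcol : ∀ j, (fun r => M.adjugate r j) = 0 ∨ (fun r => M.adjugate r j) = u := fun j => (hker _).mp (mulVec_adjugate_col M hdet j)
  have hrow : ∀ r, (fun j => M.adjugate r j) = 0 ∨ (fun j => M.adjugate r j) = fun c => u (Sum.swap c) :=
    fun r => hleft _ (adjugate_row_vecMul M hdet r)
  obtain ⟨r₀, j₀, h00⟩ : ∃ r j, M.adjugate r j ≠ 0 := by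
    by_contra hall; push Not at hall; exact hadj (Matrix.ext fun r j => hall r j)
  have hcol₀ : (fun r => M.adjugate r j₀) = u := by
    rcases hcol j₀ with h | h
    · exact absurd (congrFun h r₀) h00
    · exact h
  have hval : ∀ x : ZMod 2, x = 0 ∨ x = 1 := by decide
  rcases hval (u r) with hur | hur
  · -- `u r = 0`: the column `j` is `0` or `u`, either way the entry vanishes
    rw [hur, zero_mul]
    rcases hcol j with h | h
    · exact congrFun h r
    · rw [congrFun h r]; exact hur
  · -- `u r = 1`: the entry `(r, j₀)` is `u r = 1 ≠ 0`, so the row `r` is `u∘swap`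
    have hr0 : M.adjugate r j₀ ≠ 0 := by rw [congrFun hcol₀ r, hur]; exact one_ne_zero
    have hrowr : (fun j => M.adjugate r j) = fun c => u (Sum.swap c) := by
      rcases hrow r with h | h
      · exact absurd (congrFun h j₀) hr0
      · exact h
    rw [hur, one_mul]; exact congrFun hrowr j

/-- **The Ω-form at the Kummer bits `(0, 1, e_j)` is `A_j`.** [folklore] -/
theorem evenOmegaFormMatrix_kummer (j : Fin k) :
    evenOmegaFormMatrix p 0 1 (fun i => if i = j then 1 else 0) = (monskyMatrixEven p).adjugate (Sum.inl j) (Sum.inr j) := by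
  unfold evenOmegaFormMatrix
  simp only [zero_mul, zero_add, one_mul, mul_ite, mul_one, mul_zero, Finset.sum_ite_eq', Finset.mem_univ, if_true]
  rw [Finset.sum_eq_zero (fun a _ => Finset.sum_eq_zero (fun b _ => ?_)), add_zero]
  by_cases hab : a < b
  · rw [if_pos hab]
    by_cases hbj : b = j
    · rw [if_pos hbj]
      by_cases haj : a = j
      · exact absurd (haj.trans hbj.symm ▸ hab) (lt_irrefl _)
      · simp [haj]
    · rw [if_neg hbj]
  · rw [if_neg hab]

/-- **The Ω-form at the bits `(1, 0, e_j)` is `A_j + A′_j + G`.** [folklore] -/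
theorem evenOmegaFormMatrix_conj (j : Fin k) :
    evenOmegaFormMatrix p 1 0 (fun i => if i = j then 1 else 0) =
      (monskyMatrixEven p).adjugate (Sum.inl j) (Sum.inr j) + (monskyMatrixEven p).adjugate (Sum.inr j) (Sum.inl j) +
        ∑ i, addLegendreSym (-1) (p i) * (monskyMatrixEven p).adjugate (Sum.inl i) (Sum.inr i) := by
  unfold evenOmegaFormMatrix
  simp only [one_mul, mul_zero, zero_mul, add_zero, mul_ite, mul_one, Finset.sum_ite_eq', Finset.mem_univ, if_true]
  rw [Finset.sum_eq_zero (fun a _ => Finset.sum_eq_zero (fun b _ => ?_)), add_zero]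
  by_cases hab : a < b
  · rw [if_pos hab]
    by_cases hbj : b = j
    · rw [if_pos hbj]
      by_cases haj : a = j
      · exact absurd (haj.trans hbj.symm ▸ hab) (lt_irrefl _)
      · simp [haj]
    · rw [if_neg hbj]
  · rw [if_neg hab]

variable {n : ℕ} (D : GenusPointData n)

/-! ## §2 A square mover at `#Sel₂ = 8` under the even Ω-identity for the tuple -/

include hp hodd hinj in
/-- **SOME SQUARE MOVES `P(n)` at `#Sel₂(E_n) = 8`, under the even Ω-identity for `p`** (`n = 2∏pᵢ`, `∏pᵢ ≡ 3 (4)`, the displays, Thm 1.1).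
[cite: TianYuanZhang2017, §3.1, Prop. 3.2 (2), Thm. 3.6 (2), proof of Lemma 3.21 (p0020 L55–L58)] [cite: HeathBrown1994SelmerCongruentII, Appendix (Monsky)] [cite: Cox2013, Thm. 6.1] -/
theorem exists_sqMover_of_evenOmega (hn : n = 2 * ∏ i, p i) (h3 : (∏ i, p i) % 4 = 3) (hrec : D.recursion)
    (hLs : D.scriptLSpec) (h11 : thm11_parity_of_scriptL)
    (hΩ : ∀ (xim x2 : ZMod 2) (x : Fin k → ZMod 2), evenSquareFormMatrix p xim x2 x = evenOmegaFormMatrix p xim x2 x)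
    (hsel : Nat.card ((congruentNumberCurve n).selmerGroup 2) = 8)
    {zf : ℕ → APoint D.H} {Φf : ℕ → Finset (D.H ≃ₐ[ℚ] D.H)} {ΓHf ΓH'f : ℕ → Subgroup (D.H ≃ₐ[ℚ] D.H)}
    {σf θf : ℕ → (D.H ≃ₐ[ℚ] D.H)} {cf : D.H ≃ₐ[ℚ] D.H} (hc : D.ConjSpec cf)
    {ρ₂ : (d : ℕ) → (D.galK d →* RingClassGroup (GenusField d) 2)}
    {ρ₄ : (d : ℕ) → (D.galK d →* RingClassGroup (GenusField d) 4)}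
    (hb : ∀ d ∈ n.divisors,
      ((d % 8 = 5 ∨ d % 8 = 6) → D.CMBlockSpec d (zf d) (Φf d) (ΓHf d) (ΓH'f d) (σf d) cf) ∧
      (d % 8 = 6 → D.ThetaBlockSpec d (zf d) (ΓHf d) (ΓH'f d) (σf d) (θf d)) ∧
      (d % 8 = 7 → D.SevenBlockSpec d) ∧
      (d % 8 = 5 → D.RingClassTwoBlockSpec d (ΓHf d) (ΓH'f d) (ρ₂ d)) ∧
      (d % 8 = 6 → D.RingClassFourBlockSpec d (ΓHf d) (ΓH'f d) (ρ₄ d)) ∧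
      (d % 8 = 5 → D.FrobeniusTwoBlockSpec d (ΓH'f d)) ∧
      (d % 8 = 6 → D.FrobeniusFourBlockSpec d (ΓH'f d)) ∧
      (d % 8 = 6 → D.FrobeniusFourValueBlockSpec d (ΓH'f d) (ρ₄ d))) :
    ∃ g : D.H ≃ₐ[ℚ] D.H, D.galPt (g * g) (D.P n) ≠ D.P n := by
  have hsel' : Nat.card ((congruentNumberCurve (2 * ∏ i, p i)).selmerGroup 2) = 8 := by rw [← hn]; exact hsel
  set M := monskyMatrixEven p with hM
  set u := kerSum M with hu
  have hcard := card_ker_monskyEven_eq_two_of_card_selmer_eight p hp hodd hinj hsel'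
  obtain ⟨hne, -⟩ := ker_iff_of_card_eq_two M hcard
  have hadj := adjugate_monskyEven_apply_eq_kerSum_mul p hp hodd hinj hsel'
  have hval : ∀ x : ZMod 2, x = 0 ∨ x = 1 := by decide
  -- Kummer independence: every bit vector on `(i; i√−2, i√−p_j)` is realised
  have hqn : ∀ j, (Fin.cons 2 p : Fin (k + 1) → ℕ) j ∈ n.divisors := by
    intro j
    have hn0 : n ≠ 0 := by rw [hn]; exact mul_ne_zero two_ne_zero (Finset.prod_ne_zero_iff.mpr fun i _ => (hp i).ne_zero)
    refine Nat.mem_divisors.mpr ⟨?_, hn0⟩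
    refine Fin.cases ?_ (fun i => ?_) j
    · rw [Fin.cons_zero, hn]; exact Dvd.intro _ rfl
    · rw [Fin.cons_succ, hn]; exact Dvd.dvd.mul_left (dvd_prod_of_mem p (mem_univ i)) 2
  have hbits : ∀ (v₀ v₂ : ZMod 2) (x : Fin k → ZMod 2), ∃ g : D.H ≃ₐ[ℚ] D.H,
      (if g D.im = D.im then (0 : ZMod 2) else 1) = v₀ ∧ (if g (D.im * D.sqrtNeg 2) = D.im * D.sqrtNeg 2 then (0 : ZMod 2) else 1) = v₂ ∧
        (fun i => if g (D.im * D.sqrtNeg (p i)) = D.im * D.sqrtNeg (p i) then (0 : ZMod 2) else 1) = x := by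
    intro v₀ v₂ x
    obtain ⟨g, hg0, hg⟩ := exists_aut_im_bits_eq D (Fin.cons 2 p) (prime_cons_two p hp) (injective_cons_two p hodd hinj) hqn v₀ (Fin.cons v₂ x)
    refine ⟨g, hg0, ?_, funext fun i => ?_⟩
    · have := hg 0; rwa [Fin.cons_zero, Fin.cons_zero] at this
    · have := hg i.succ; rwa [Fin.cons_succ, Fin.cons_succ] at this
  -- the value of the Ω-form at the chosen bits is `1`
  have hmover : ∀ (v₀ v₂ : ZMod 2) (x : Fin k → ZMod 2), evenOmegaFormMatrix p v₀ v₂ x = 1 →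
      ∃ g : D.H ≃ₐ[ℚ] D.H, D.galPt (g * g) (D.P n) ≠ D.P n := by
    intro v₀ v₂ x h1
    obtain ⟨g, hg0, hg2, hgx⟩ := hbits v₀ v₂ x
    refine ⟨g, galPt_mul_self_P_ne_of_evenSquareFormMatrix_eq_one p hp hodd hinj D hn h3 hrec hLs h11 hc hb g ?_⟩
    rw [hg0, hg2, hgx, hΩ, h1]
  by_cases hA : ∃ j, u (Sum.inl j) = 1
  · obtain ⟨j, hj⟩ := hA
    refine hmover 0 1 (fun i => if i = j then 1 else 0) ?_
    rw [evenOmegaFormMatrix_kummer, hadj, Sum.swap_inr, ← hu, hj, one_mul]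
  · push Not at hA
    have hA0 : ∀ j, u (Sum.inl j) = 0 := fun j => by rcases hval (u (Sum.inl j)) with h | h; exact h; exact absurd h (hA j)
    obtain ⟨j, hj⟩ : ∃ j, u (Sum.inr j) = 1 := by
      by_contra hno; push Not at hno
      apply hne; funext c
      rcases c with j | j
      · exact hA0 j
      · rcases hval (u (Sum.inr j)) with h | h
        · exact h
        · exact absurd h (hno j)
    refine hmover 1 0 (fun i => if i = j then 1 else 0) ?_
    rw [evenOmegaFormMatrix_conj, hadj, hadj, Sum.swap_inr, Sum.swap_inl, ← hu, hA0 j, hj, zero_mul, zero_add, one_mul,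
      Finset.sum_eq_zero (fun i _ => by rw [hadj, ← hu, hA0 i, zero_mul, mul_zero]), add_zero]

/-! ## §3 `#Sel₂ = 8 ⟹ BSD₂` on ALL of `S(6)` under the even Ω-identity -/

include hp hodd hinj in
/-- **`#Sel₂(E_n) = 8 ⟹ ord = rank = 1 ∧ Ш[2^∞] = 0 ∧ BSD₂(E_n)` for EVERY square-free `n ≡ 6 (mod 8)`, from the named facts, CONDITIONAL on the even
Ω-identity for the tuple** (`OfFacts` shape): no `u¹ ≠ 0`, no adjugate entry, no class-number parity hypothesis.
[cite: TianYuanZhang2017, Thm. 1.1, Thm. 3.5, Lemma 3.18, §3.1, Prop. 3.2 (2), Thm. 3.6 (2), proof of Lemma 3.21] [cite: HeathBrown1994SelmerCongruentII, Appendix (Monsky)] [cite: Miller2011LMS, Def. 1.1] -/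
theorem selmerEight_six_bsdp_two_of_evenOmega_of_facts (hF : tyz_cmPointRingClassFrobeniusValueData ∧ thm11_parity_of_scriptL)
    (hΩ : ∀ (xim x2 : ZMod 2) (x : Fin k → ZMod 2), evenSquareFormMatrix p xim x2 x = evenOmegaFormMatrix p xim x2 x)
    (hn : n = 2 * ∏ i, p i) (h3 : (∏ i, p i) % 4 = 3) (hsq : Squarefree n)
    (hsel : haveI := isElliptic_congruentNumberCurve hsq.ne_zero; Nat.card ((congruentNumberCurve n).selmerGroup 2) = 8) :
    haveI := isElliptic_congruentNumberCurve hsq.ne_zero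
    (congruentNumberCurve n).analyticRank = 1 ∧ (congruentNumberCurve n).mordellWeilRank = 1 ∧
      AddCommGroup.primaryComponent (congruentNumberCurve n).sha 2 = ⊥ ∧ BSDp (congruentNumberCurve n) 2 := by
  have hp2 : ∀ i, p i ≠ 2 := ne_two_of_odd p hodd
  have hmodd : Odd (∏ i, p i) := odd_prod p hp hp2
  have h6 : n % 8 = 6 := by rcases hmodd with ⟨r, hr⟩; omega
  obtain ⟨D, hPr, hV⟩ := hF.1 n hsq (Or.inr (Or.inl h6))
  obtain ⟨hLs, -, hrec, -, h35, -, -, -, h318, -, -⟩ := hPr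
  obtain ⟨z, Φ, ΓH, ΓH', σ, θ, cc, ρ₂, ρ₄, hcc, hbl⟩ := hV
  obtain ⟨g, hmove⟩ := exists_sqMover_of_evenOmega p hp hodd hinj D hn h3 hrec hLs hF.2 hΩ hsel hcc hbl
  exact GaloisMotion.rankOne_sha_bsdp_two_congruentNumberCurve_of_selmerEight_of_mover_even hsq h6 hsel D h35 hLs h318 (g * g)
    (mul_self_apply_im D g) (fun d hd => mul_self_apply_sqrtNeg D g hd) hmove

end Summit.BirchSwinnertonDyer.PrintCf2.MoverAssembly

end
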